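import Summits.QuantumFields.YangMills.Theorems.BalabanUVNodesPortS1QtCDtChange

/-!
# Port S1, socket (o3) first bricks — THE DERIVATIVE OF `C̃_ℂ` (Cauchy bound `‖DC̃_ℂ(Y)‖ ≤ 4C₂‖Y‖`), THE INVERSE CHANGE `Ψ(B′) = B′ + h_ℂ C̃_ℂ(B′)` IS HOLOMORPHIC WITH DERIVATIVE `1 + h_ℂ∘DC̃_ℂ(B′)`,
# AND THAT DERIVATIVE IS INVERTIBLE ON THE BALL (`‖h_ℂ∘DC̃_ℂ(B′)‖ ≤ 4C₂b‖B′‖ < 1`) — the operator whose `det⁻¹ = det(1 − h δD̃∕δB)` is print's Jacobian (2.12)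

Cell `ym-nodeO-ideate`, porter seat PT-A-1 (gen 9); `--kind proof --supports stmt-QuantumFields-27930 --as helper`; count-neutral.  [I] = [Balaban1987RG1]; [15] = [Balaban1985Variational].

WHY ((o3) = `Tr log(1 − h δD̃∕δB)`).  With `Φ(B) = B − h_ℂD̃(B)` and `Ψ(B′) = B′ + h_ℂC̃_ℂ(B′)` one has `Ψ ∘ Φ = id` on the ball (§3, lit `psi_phi`) and `D̃ = C̃_ℂ ∘ Φ` (the fixed-point equation), so
`1 − h δD̃∕δB (B) = (DΨ(B′))⁻¹ = (1 + h_ℂ DC̃_ℂ(B′))⁻¹` at `B′ = Φ(B)`: the Jacobian of print's translation is carried by the HOLOMORPHIC, EXPLICIT operator family `B′ ↦ 1 + h_ℂ∘DC̃_ℂ(B′)`, invertible by a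
Neumann series on the ball.  This file supplies that family and its bounds; `det`∕`Tr log` of it is the next brick.

WHAT IS PROVED (letters as in (o1-ε); `R = 1∕(10⁸dL)`, `C₂ = 2∕R²`):
* §1 `differentiableAt_recordCtC`, `hasFDerivAt_recordCtC_zero` (`DC̃_ℂ(0) = 0`: `C̃ = Q̃ − DQ̃(0)`), ★★ `norm_fderiv_recordCtC_le` — CAUCHY: `‖DC̃_ℂ(Y)‖ ≤ 4C₂‖Y‖` for `‖Y‖ < R∕2` (the circle
  `|ζ| = ‖Y‖∕‖Q‖` through `Y` in direction `Q` stays in `‖·‖ ≤ 2‖Y‖ < R`, where `‖C̃_ℂ‖ ≤ 4C₂‖Y‖²`; Mathlib `Complex.norm_deriv_le_of_forall_mem_sphere_norm_le`).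
* §2 ★ `hasFDerivAt_recordPsi` — `Ψ` has derivative `1 + h_ℂ ∘L DC̃_ℂ(B′)` at every `‖B′‖ < R`; `hasFDerivAt_recordPsi_zero` (`DΨ(0) = 1`); ★ `norm_hop_comp_fderiv_recordCtC_le` (`≤ 4C₂b‖B′‖`);
  ★★ `isUnit_fderiv_recordPsi` — `1 + h_ℂ∘DC̃_ℂ(B′)` is a unit of the Banach algebra `𝒴 →L[ℂ] 𝒴` for `‖B′‖ < ρ` under `9C₂bρ < 1`, `3ρ ≤ R` (Neumann series, `4C₂bρ < 1`).
* §3 `recordPsi_recordPhi` — `Ψ(Φ B) = B` on `‖B‖ < ρ` for any solution family `Dt` (lit `psi_phi`).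

HONEST FRAMING.  Derivative bookkeeping of the translation; `det (1 + h_ℂ DC̃_ℂ)`, its `Tr log` series and analyticity in `B′` ((o3) proper), and the Fréchet-differentiability of `D̃` itself are NOT here;
`stub_FE` (XXL) ∕ `stub_P0C` OPEN, ⟨27930⟩ OPEN (1∕3); NODE O 0∕1; COUNT 8∕28 · K 1∕4 UNMOVED; finite `𝕋⁴_{L^K}` at fixed ε — NOT continuum ∕ OS; **the Yang–Mills mass gap (Clay) is NOT proved by
any of this.**  No `sorry`; standard axioms only.
-/

noncomputable section

open scoped BigOperators Matrix.Norms.L2Operator Topology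

open Set Metric Filter

namespace Summit.QuantumFields.YangMills.Theorems.BalabanUVNodesPortS1

open Summit.QuantumFields.YangMills.Theorems.K0RecordFormatNames
open Literature.MathematicalPhysics.QuantumFieldTheory.Balaban1983to89
open Literature.MathematicalPhysics.QuantumFieldTheory.Balaban1983to89.Node00
open Literature.MathematicalPhysics.QuantumFieldTheory.Balaban1983to89.T4Continuum (T4Family)
open Literature.MathematicalPhysics.QuantumFieldTheory.Balaban1983to89.BlockAveraging (Small Idx)
open Literature.MathematicalPhysics.QuantumFieldTheory.Balaban1983to89.ExpMeanLog (expMeanLogSU)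
open _root_.Matrix

variable (F : T4Family)

/-! ## §1  The derivative of `C̃_ℂ` -/

/-- `C̃_ℂ(Vk)` is ℂ-differentiable at every point of the ball `‖Y‖ < R`. [cite: Balaban1987RG1, p.267] -/
theorem differentiableAt_recordCtC (k K : ℕ) (hk : k + 1 ≤ (F.P K).m + (F.P K).K) (Vk : GaugeField (F.P K) k (SU 2)) {ε : ℝ}
    (hε : ∀ (c : PBond (F.P K) (k + 1)) (i : Idx (F.P K)), ‖loopM (coeField Vk) c i - 1‖ ≤ ε) (hε50 : ε ≤ 1 / 50)
    (hVk : ∀ c, Small expMeanLogSU Vk c) {Y : FluctIdx F k K → ℂ} (hY : ‖Y‖ < 1 / (10 ^ 8 * (F.P K).d * (F.P K).L)) :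
    DifferentiableAt ℂ (recordCtC F k K Vk) Y :=
  (differentiableOn_recordCtC_ball F k K hk Vk hε hε50 hVk).differentiableAt
    ((isOpen_lt continuous_norm continuous_const).mem_nhds hY)

/-- `DC̃_ℂ(0) = 0` (`C̃ = Q̃ − LQ̃` with `LQ̃ = DQ̃(0)`). [cite: Balaban1987RG1, (1.5) p.261, p.267] -/
theorem hasFDerivAt_recordCtC_zero (k K : ℕ) (hk : k + 1 ≤ (F.P K).m + (F.P K).K) (Vk : GaugeField (F.P K) k (SU 2)) {ε : ℝ}
    (hε : ∀ (c : PBond (F.P K) (k + 1)) (i : Idx (F.P K)), ‖loopM (coeField Vk) c i - 1‖ ≤ ε) (hε50 : ε ≤ 1 / 50)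
    (hVk : ∀ c, Small expMeanLogSU Vk c) :
    HasFDerivAt (recordCtC F k K Vk) (0 : (FluctIdx F k K → ℂ) →L[ℂ] (PBond (F.P K) (k + 1) → MatA 2)) 0 := by
  have hQ : HasFDerivAt (recordQtC F k K Vk) (recordLQtC F k K Vk) 0 :=
    (differentiableAt_recordQtC_zero F k K hk Vk hε hε50 hVk).hasFDerivAt
  have hL : HasFDerivAt (recordLQtC F k K Vk) (recordLQtC F k K Vk) 0 := (recordLQtC F k K Vk).hasFDerivAt
  have h := hQ.sub hL
  rw [sub_self] at h
  exact h

/-- ★★ **CAUCHY BOUND ON THE DERIVATIVE OF `C̃_ℂ`**: `‖DC̃_ℂ(Y)‖ ≤ 4C₂‖Y‖` for `‖Y‖ < R∕2` — along the complex line `ζ ↦ Y + ζQ` the circle `|ζ| = ‖Y‖∕‖Q‖` lies in `‖·‖ ≤ 2‖Y‖ < R`, where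
`‖C̃_ℂ‖ ≤ C₂(2‖Y‖)²`; Cauchy's estimate gives `‖DC̃_ℂ(Y)Q‖ ≤ 4C₂‖Y‖²∕(‖Y‖∕‖Q‖)`. [cite: Balaban1985Variational, (49)–(55) pp.285–286; Balaban1987RG1, p.267] -/
theorem norm_fderiv_recordCtC_le (k K : ℕ) (hk : k + 1 ≤ (F.P K).m + (F.P K).K) (Vk : GaugeField (F.P K) k (SU 2)) {ε : ℝ}
    (hε : ∀ (c : PBond (F.P K) (k + 1)) (i : Idx (F.P K)), ‖loopM (coeField Vk) c i - 1‖ ≤ ε) (hε50 : ε ≤ 1 / 50)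
    (hVk : ∀ c, Small expMeanLogSU Vk c) {Y : FluctIdx F k K → ℂ} (hY : ‖Y‖ < 1 / (10 ^ 8 * (F.P K).d * (F.P K).L) / 2) :
    ‖fderiv ℂ (recordCtC F k K Vk) Y‖ ≤ 4 * (2 * 1 / (1 / (10 ^ 8 * (F.P K).d * (F.P K).L)) ^ 2) * ‖Y‖ := by
  have hQA := quadAnalytic_recordCtC F k K hk Vk hε hε50 hVk
  have hd : (1 : ℝ) ≤ (F.P K).d := by exact_mod_cast (F.P K).hd
  have hL : (1 : ℝ) ≤ (F.P K).L := by exact_mod_cast (F.P K).hL.2.le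
  have hR : (0 : ℝ) < 1 / (10 ^ 8 * (F.P K).d * (F.P K).L) := by positivity
  have hYR : ‖Y‖ < 1 / (10 ^ 8 * (F.P K).d * (F.P K).L) := by linarith
  have hdiff := differentiableAt_recordCtC F k K hk Vk hε hε50 hVk hYR
  refine ContinuousLinearMap.opNorm_le_bound _ (by positivity) fun Q => ?_
  by_cases hY0 : Y = 0
  · subst hY0
    rw [(hasFDerivAt_recordCtC_zero F k K hk Vk hε hε50 hVk).fderiv]
    simp
  by_cases hQ0 : Q = 0
  · subst hQ0; simp
  have hYn : 0 < ‖Y‖ := norm_pos_iff.2 hY0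
  have hQn : 0 < ‖Q‖ := norm_pos_iff.2 hQ0
  set r : ℝ := ‖Y‖ / ‖Q‖ with hrdef
  have hr : 0 < r := div_pos hYn hQn
  have hrQ : r * ‖Q‖ = ‖Y‖ := by rw [hrdef]; field_simp
  set g : ℂ → (PBond (F.P K) (k + 1) → MatA 2) := fun ζ => recordCtC F k K Vk (Y + ζ • Q) with hgdef
  -- the derivative of `g` at `0` is `DC̃_ℂ(Y) Q`
  have hline : HasDerivAt (fun ζ : ℂ => Y + ζ • Q) Q 0 := by
    simpa using ((hasDerivAt_id (0 : ℂ)).smul_const Q).const_add Y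
  have hg : HasDerivAt g (fderiv ℂ (recordCtC F k K Vk) Y Q) 0 := by
    have h2 : HasFDerivAt (recordCtC F k K Vk) (fderiv ℂ (recordCtC F k K Vk) Y) (Y + (0 : ℂ) • Q) := by
      rw [zero_smul, add_zero]; exact hdiff.hasFDerivAt
    exact h2.comp_hasDerivAt (0 : ℂ) hline
  -- on the closed disc `|ζ| ≤ r` the line stays in `‖·‖ ≤ 2‖Y‖ < R`
  have hin : ∀ ζ : ℂ, ‖ζ‖ ≤ r → ‖Y + ζ • Q‖ ≤ 2 * ‖Y‖ := fun ζ hζ => by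
    calc ‖Y + ζ • Q‖ ≤ ‖Y‖ + ‖ζ • Q‖ := norm_add_le _ _
      _ = ‖Y‖ + ‖ζ‖ * ‖Q‖ := by rw [norm_smul]
      _ ≤ ‖Y‖ + r * ‖Q‖ := by gcongr
      _ = 2 * ‖Y‖ := by rw [hrQ]; ring
  have hsphere : ∀ ζ ∈ sphere (0 : ℂ) r, ‖g ζ‖ ≤ 4 * (2 * 1 / (1 / (10 ^ 8 * (F.P K).d * (F.P K).L)) ^ 2) * ‖Y‖ ^ 2 := by
    intro ζ hζ
    have hζ' : ‖ζ‖ ≤ r := by rw [mem_sphere_zero_iff_norm.1 hζ]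
    have hlt : ‖Y + ζ • Q‖ < 1 / (10 ^ 8 * (F.P K).d * (F.P K).L) := by linarith [hin ζ hζ']
    calc ‖g ζ‖ ≤ (2 * 1 / (1 / (10 ^ 8 * (F.P K).d * (F.P K).L)) ^ 2) * ‖Y + ζ • Q‖ ^ 2 := hQA.quad _ hlt
      _ ≤ (2 * 1 / (1 / (10 ^ 8 * (F.P K).d * (F.P K).L)) ^ 2) * (2 * ‖Y‖) ^ 2 := by
          gcongr; exact hin ζ hζ'
      _ = 4 * (2 * 1 / (1 / (10 ^ 8 * (F.P K).d * (F.P K).L)) ^ 2) * ‖Y‖ ^ 2 := by ring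
  have hsub : closure (ball (0 : ℂ) r) ⊆ {ζ : ℂ | ‖Y + ζ • Q‖ < 1 / (10 ^ 8 * (F.P K).d * (F.P K).L)} := by
    intro ζ hζ
    have hζ' : ‖ζ‖ ≤ r := by
      have := closure_ball_subset_closedBall hζ
      rwa [mem_closedBall_zero_iff] at this
    show ‖Y + ζ • Q‖ < _
    linarith [hin ζ hζ']
  have hdc : DiffContOnCl ℂ g (ball (0 : ℂ) r) := ((hQA.lineAnalytic Y Q).mono hsub).diffContOnCl
  have hC := Complex.norm_deriv_le_of_forall_mem_sphere_norm_le hr hdc hsphere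
  rw [hg.deriv] at hC
  calc ‖fderiv ℂ (recordCtC F k K Vk) Y Q‖ ≤ 4 * (2 * 1 / (1 / (10 ^ 8 * (F.P K).d * (F.P K).L)) ^ 2) * ‖Y‖ ^ 2 / r := hC
    _ = 4 * (2 * 1 / (1 / (10 ^ 8 * (F.P K).d * (F.P K).L)) ^ 2) * ‖Y‖ * ‖Q‖ := by
        rw [hrdef]; field_simp

/-! ## §2  `Ψ(B′) = B′ + h_ℂ C̃_ℂ(B′)`: derivative and its invertibility -/

/-- ★ **`DΨ(B′) = 1 + h_ℂ ∘ DC̃_ℂ(B′)`** for `‖B′‖ < R`. [cite: Balaban1987RG1, p.267–268] -/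
theorem hasFDerivAt_recordPsi (k K : ℕ) (hk : k + 1 ≤ (F.P K).m + (F.P K).K) (Vk : GaugeField (F.P K) k (SU 2)) {ε : ℝ}
    (hε : ∀ (c : PBond (F.P K) (k + 1)) (i : Idx (F.P K)), ‖loopM (coeField Vk) c i - 1‖ ≤ ε) (hε50 : ε ≤ 1 / 50)
    (hVk : ∀ c, Small expMeanLogSU Vk c) {Y : FluctIdx F k K → ℂ} (hY : ‖Y‖ < 1 / (10 ^ 8 * (F.P K).d * (F.P K).L)) :
    HasFDerivAt (fun B' : FluctIdx F k K → ℂ => B' + hopLinGraphC F k K Vk (recordCtC F k K Vk B'))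
      ((1 : (FluctIdx F k K → ℂ) →L[ℂ] (FluctIdx F k K → ℂ)) +
        (LinearMap.toContinuousLinearMap (hopLinGraphC F k K Vk)).comp (fderiv ℂ (recordCtC F k K Vk) Y)) Y := by
  have h1 : HasFDerivAt (fun B' : FluctIdx F k K → ℂ => B') (1 : (FluctIdx F k K → ℂ) →L[ℂ] (FluctIdx F k K → ℂ)) Y := hasFDerivAt_id Y
  have h2 : HasFDerivAt (fun B' => hopLinGraphC F k K Vk (recordCtC F k K Vk B'))
      ((LinearMap.toContinuousLinearMap (hopLinGraphC F k K Vk)).comp (fderiv ℂ (recordCtC F k K Vk) Y)) Y :=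
    (LinearMap.toContinuousLinearMap (hopLinGraphC F k K Vk)).hasFDerivAt.comp Y
      (differentiableAt_recordCtC F k K hk Vk hε hε50 hVk hY).hasFDerivAt
  exact h1.add h2

/-- `DΨ(0) = 1`. [cite: Balaban1987RG1, p.267–268] -/
theorem hasFDerivAt_recordPsi_zero (k K : ℕ) (hk : k + 1 ≤ (F.P K).m + (F.P K).K) (Vk : GaugeField (F.P K) k (SU 2)) {ε : ℝ}
    (hε : ∀ (c : PBond (F.P K) (k + 1)) (i : Idx (F.P K)), ‖loopM (coeField Vk) c i - 1‖ ≤ ε) (hε50 : ε ≤ 1 / 50)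
    (hVk : ∀ c, Small expMeanLogSU Vk c) :
    HasFDerivAt (fun B' : FluctIdx F k K → ℂ => B' + hopLinGraphC F k K Vk (recordCtC F k K Vk B'))
      (1 : (FluctIdx F k K → ℂ) →L[ℂ] (FluctIdx F k K → ℂ)) 0 := by
  have hd : (1 : ℝ) ≤ (F.P K).d := by exact_mod_cast (F.P K).hd
  have hL : (1 : ℝ) ≤ (F.P K).L := by exact_mod_cast (F.P K).hL.2.le
  have h := hasFDerivAt_recordPsi F k K hk Vk hε hε50 hVk (Y := 0) (by rw [norm_zero]; positivity)
  rw [(hasFDerivAt_recordCtC_zero F k K hk Vk hε hε50 hVk).fderiv, ContinuousLinearMap.comp_zero, add_zero] at h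
  exact h

/-- ★ `‖h_ℂ ∘ DC̃_ℂ(B′)‖ ≤ b·4C₂‖B′‖` for `‖B′‖ < R∕2` under `‖h_ℂ‖ ≤ b`. [cite: Balaban1985Variational, (98) p.292; Balaban1987RG1, p.267] -/
theorem norm_hop_comp_fderiv_recordCtC_le (k K : ℕ) (hk : k + 1 ≤ (F.P K).m + (F.P K).K) (Vk : GaugeField (F.P K) k (SU 2)) {ε : ℝ}
    (hε : ∀ (c : PBond (F.P K) (k + 1)) (i : Idx (F.P K)), ‖loopM (coeField Vk) c i - 1‖ ≤ ε) (hε50 : ε ≤ 1 / 50)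
    (hVk : ∀ c, Small expMeanLogSU Vk c) {b : ℝ} (hb : 0 ≤ b) (hHop : ∀ X, ‖hopLinGraphC F k K Vk X‖ ≤ b * ‖X‖)
    {Y : FluctIdx F k K → ℂ} (hY : ‖Y‖ < 1 / (10 ^ 8 * (F.P K).d * (F.P K).L) / 2) :
    ‖(LinearMap.toContinuousLinearMap (hopLinGraphC F k K Vk)).comp (fderiv ℂ (recordCtC F k K Vk) Y)‖ ≤
      b * (4 * (2 * 1 / (1 / (10 ^ 8 * (F.P K).d * (F.P K).L)) ^ 2) * ‖Y‖) := by
  have hh : ‖LinearMap.toContinuousLinearMap (hopLinGraphC F k K Vk)‖ ≤ b :=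
    ContinuousLinearMap.opNorm_le_bound _ hb fun X => hHop X
  calc ‖(LinearMap.toContinuousLinearMap (hopLinGraphC F k K Vk)).comp (fderiv ℂ (recordCtC F k K Vk) Y)‖
      ≤ ‖LinearMap.toContinuousLinearMap (hopLinGraphC F k K Vk)‖ * ‖fderiv ℂ (recordCtC F k K Vk) Y‖ := ContinuousLinearMap.opNorm_comp_le _ _
    _ ≤ b * (4 * (2 * 1 / (1 / (10 ^ 8 * (F.P K).d * (F.P K).L)) ^ 2) * ‖Y‖) :=
        mul_le_mul hh (norm_fderiv_recordCtC_le F k K hk Vk hε hε50 hVk hY) (norm_nonneg (fderiv ℂ (recordCtC F k K Vk) Y)) hb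

/-- ★★ **`DΨ(B′) = 1 + h_ℂ∘DC̃_ℂ(B′)` IS INVERTIBLE ON THE BALL**: for `‖B′‖ < ρ` with `9C₂bρ < 1`, `3ρ ≤ R`, `‖h_ℂ∘DC̃_ℂ(B′)‖ < 1`, so `1 + h_ℂ∘DC̃_ℂ(B′)` is a unit (Neumann series) — the operator whose
inverse determinant is print's Jacobian `det(1 − h δD̃∕δB)`. [cite: Balaban1987RG1, (2.12) p.268; Balaban1985Variational, (98) p.292] -/
theorem isUnit_fderiv_recordPsi (k K : ℕ) (hk : k + 1 ≤ (F.P K).m + (F.P K).K) (Vk : GaugeField (F.P K) k (SU 2)) {ε : ℝ}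
    (hε : ∀ (c : PBond (F.P K) (k + 1)) (i : Idx (F.P K)), ‖loopM (coeField Vk) c i - 1‖ ≤ ε) (hε50 : ε ≤ 1 / 50)
    (hVk : ∀ c, Small expMeanLogSU Vk c) {b ρ : ℝ} (hb : 0 ≤ b) (hHop : ∀ X, ‖hopLinGraphC F k K Vk X‖ ≤ b * ‖X‖)
    (hq : 9 * (2 * 1 / (1 / (10 ^ 8 * (F.P K).d * (F.P K).L)) ^ 2) * b * ρ < 1) (hρ : 3 * ρ ≤ 1 / (10 ^ 8 * (F.P K).d * (F.P K).L))
    {Y : FluctIdx F k K → ℂ} (hY : ‖Y‖ < ρ) :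
    ‖(LinearMap.toContinuousLinearMap (hopLinGraphC F k K Vk)).comp (fderiv ℂ (recordCtC F k K Vk) Y)‖ < 1 ∧
      IsUnit ((1 : (FluctIdx F k K → ℂ) →L[ℂ] (FluctIdx F k K → ℂ)) +
        (LinearMap.toContinuousLinearMap (hopLinGraphC F k K Vk)).comp (fderiv ℂ (recordCtC F k K Vk) Y)) := by
  have hρ0 : 0 ≤ ρ := (norm_nonneg _).trans hY.le
  have hY2 : ‖Y‖ < 1 / (10 ^ 8 * (F.P K).d * (F.P K).L) / 2 := by linarith
  have hC₂0 : (0 : ℝ) ≤ 2 * 1 / (1 / (10 ^ 8 * (F.P K).d * (F.P K).L)) ^ 2 := by positivity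
  have h1 := norm_hop_comp_fderiv_recordCtC_le F k K hk Vk hε hε50 hVk hb hHop hY2
  have hlt : ‖(LinearMap.toContinuousLinearMap (hopLinGraphC F k K Vk)).comp (fderiv ℂ (recordCtC F k K Vk) Y)‖ < 1 := by
    have h2 : b * (4 * (2 * 1 / (1 / (10 ^ 8 * (F.P K).d * (F.P K).L)) ^ 2) * ‖Y‖) ≤
        b * (4 * (2 * 1 / (1 / (10 ^ 8 * (F.P K).d * (F.P K).L)) ^ 2) * ρ) := by gcongr
    nlinarith [mul_nonneg (mul_nonneg hC₂0 hb) hρ0]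
  refine ⟨hlt, ?_⟩
  have hu : IsUnit ((1 : (FluctIdx F k K → ℂ) →L[ℂ] (FluctIdx F k K → ℂ)) -
      -((LinearMap.toContinuousLinearMap (hopLinGraphC F k K Vk)).comp (fderiv ℂ (recordCtC F k K Vk) Y))) :=
    (Units.oneSub (-((LinearMap.toContinuousLinearMap (hopLinGraphC F k K Vk)).comp (fderiv ℂ (recordCtC F k K Vk) Y)))
      (by rwa [norm_neg])).isUnit
  rwa [sub_neg_eq_add] at hu

/-! ## §3  `Ψ ∘ Φ = id` on the ball -/

/-- `Ψ(Φ B) = B` for `‖B‖ < ρ`, for any solution family `Dt` of the fixed-point equation (lit `psi_phi`). [cite: Balaban1987RG1, p.267–268] -/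
theorem recordPsi_recordPhi {k K : ℕ} (Vk : GaugeField (F.P K) k (SU 2)) {ρ : ℝ} {Dt : (FluctIdx F k K → ℂ) → (PBond (F.P K) (k + 1) → MatA 2)}
    (hfix : ∀ B, ‖B‖ < ρ → recordCtC F k K Vk (B - hopLinGraphC F k K Vk (Dt B)) = Dt B) {B : FluctIdx F k K → ℂ} (hB : ‖B‖ < ρ) :
    (B - hopLinGraphC F k K Vk (Dt B)) + hopLinGraphC F k K Vk (recordCtC F k K Vk (B - hopLinGraphC F k K Vk (Dt B))) = B :=
  B12Lineariz267.psi_phi (hfix B hB)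

end Summit.QuantumFields.YangMills.Theorems.BalabanUVNodesPortS1

end
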